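import Literature.NumberTheory.LFunctions.ZetaSpacingDensityRHProofs
import HarnessLib

/-!
# GapsEvoDoors — the WINDOW form of Bui–Goldston–Milinovich–Montgomery's Proposition 1
# (part 1: the pair count)

Analytic support for items stmt-RiemannHypothesis-23032 (`FloorSpacingCriterionAll`) and
stmt-RiemannHypothesis-22422 (`FFSpacingCriterionAll`) of route GapsEvoDoors (cell rh-gaps,
D-0143/D-0145). Bui–Goldston–Milinovich–Montgomery 2023 (arXiv:2208.02359), Proposition 1, proves
under RH, for `r ∈ 𝒜(λ)` (`r̂ ≥ 0` EVERYWHERE), `#{(γ,γ') : |γ − γ'| ≤ 2πλ/log T} ≥ (1 + c(λ;r) −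
o(1)) N(T)` with `c = r̂(0) − 1 + 2∫₀¹ α r̂`, by DROPPING `∫_{|α|>1} F r̂ ≥ 0` (tree theorem
`BGMM2023.pairCount_ge_of_RH`). This file proves the same inequality when, instead of `r̂ ≥ 0` on
`[−1, 1] ∪ {|α| > 1}`, one only knows `r̂ ≥ 0` for `|α| ≥ Δ` and is GIVEN an eventual pointwise
minorant `m(α) ≤ F(α, T) r̂(α)` on the window `1 < |α| ≤ Δ` (even, continuous `m`): then
`#pairs ≥ (r̂(0) + 2∫₀¹ α r̂ + 2∫₁^Δ m − o(1)) N(T)` (`pairCount_ge_window`). On `[−1, 1]` the sign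
of `r̂` is free because Montgomery's theorem is used two-sidedly
(`Montgomery.montgomery_pair_correlation_sqrtLog`: `|F − T^{−2|α|} log T − |α|| ≤ C(·)/√log T`);
the mass of `T^{−2|α|} log T` at `0` is handled by continuity of `r̂` at `0` and the kernel masses
`∫_{−c}^{c} T^{−2|α|} log T dα → 1` (`Montgomery.tendsto_integral_rpow_abs_mul_log_mul`), and
`N(T) ∼ (T/2π) log T` (`RudnickSarnak.tendsto_zetaZeroCount_div_main`). Part 2
(`GapsEvoDoorsWindowCriterion.lean`) re-runs the §4 assembly of Theorem 3 (first clause) from a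
pair-count hypothesis and packages the window criterion; the two route items are then short
specialisations: floor fragment `F ≥ f₀ − ε` ⇒ `m = f·r̂`; two-sided fragment `|F − 1| ≤ ε` ⇒
`m = (1 − ε) r̂⁺ − (1 + ε) r̂⁻`.

All inputs are tree theorems; RH is Mathlib's `RiemannHypothesis`, an explicit hypothesis. Nothing
here bears on the truth of RH.

References: Bui–Goldston–Milinovich–Montgomery, Acta Arith. 210 (2023) 133–153 (arXiv:2208.02359),
§2 Proposition 1 and §4; H. L. Montgomery, Proc. Sympos. Pure Math. 24 (1973), Theorem;
Goldston–Montgomery 1987 / BGSTB 2025 §7 for the `1/√log T` form.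
-/

noncomputable section

open Complex Filter Set MeasureTheory Topology Finset Real
open scoped FourierTransform

set_option linter.dupNamespace false  -- the mandated namespace repeats `RiemannHypothesis`

namespace Summit.RiemannHypothesis.RiemannHypothesis.Theorems.GapsEvoDoorsWindow

open Literature.NumberTheory.LFunctions Literature.NumberTheory.LFunctions.BGMM2023

/-- **Fourier inversion `𝓕r̂ = r`** for a real, even, continuous, integrable `r` whose cosine
transform is integrable (the tree's `BGMM2023.fourier_cosTransform_eq` assumes `r̂ ≥ 0` instead,
only to derive `r̂ ∈ L¹`). -/
theorem fourier_cosTransform_eq_of_integrable {r : ℝ → ℝ} (hc : Continuous r) (hi : Integrable r)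
    (heven : ∀ u, r (-u) = r u) (hti : Integrable (cosTransform r)) (x : ℝ) :
    𝓕 (fun ξ : ℝ ↦ (cosTransform r ξ : ℂ)) x = (r x : ℂ) := by
  set f : ℝ → ℂ := fun u ↦ (r u : ℂ) with hfdef
  have hf : Integrable f := hi.ofReal
  have hfc : Continuous f := Complex.continuous_ofReal.comp hc
  have hF : 𝓕 f = fun ξ ↦ (cosTransform r ξ : ℂ) := funext (fourier_ofReal_eq_cosTransform heven hi)
  have hFi : Integrable (𝓕 f) := by rw [hF]; exact hti.ofReal
  have hinv := hfc.fourierInv_fourier_eq hf hFi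
  rw [hF] at hinv
  have h1 : 𝓕⁻ (fun ξ : ℝ ↦ (cosTransform r ξ : ℂ)) (-x) = f (-x) := by rw [hinv]
  rw [Real.fourierInv_eq_fourier_neg, neg_neg] at h1
  rw [h1, hfdef]; dsimp only; rw [heven]

set_option maxHeartbeats 400000 in
/-- **Proposition 1, window form.** Assume RH; let `λ > 0`, `Δ ≥ 1`, `r` even, continuous,
integrable with `r̂ ∈ L¹`, `r ≤ 1`, `r ≤ 0` off `[−λ, λ]`, `r̂ ≥ 0` for `|α| ≥ Δ`, and let `m` be
an even continuous function with `m(α) ≤ F(α,T) r̂(α)` for `1 < |α| ≤ Δ` and all large `T`. Then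
for every `ε > 0` and all large `T`,
`(r̂(0) + 2∫₀¹ α r̂ + 2∫₁^Δ m − ε) · N(T) ≤ #{(γ, γ') ∈ (0,T]² : |γ − γ'| ≤ 2πλ/log T}`. -/
theorem pairCount_ge_window (hRH : RiemannHypothesis) {lam Δ : ℝ} (hΔ : 1 ≤ Δ)
    {r : ℝ → ℝ} (hev : ∀ u, r (-u) = r u) (hco : Continuous r) (hin : Integrable r)
    (hti : Integrable (cosTransform r)) (hle : ∀ u, r u ≤ 1) (hno : ∀ u, lam < |u| → r u ≤ 0)
    (htail : ∀ α, Δ ≤ |α| → 0 ≤ cosTransform r α)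
    {m : ℝ → ℝ} (hmc : Continuous m) (hme : ∀ a, m (-a) = m a)
    (hwin : ∃ T₀ : ℝ, ∀ T : ℝ, T₀ ≤ T → ∀ α : ℝ, 1 < |α| → |α| ≤ Δ →
        m α ≤ montgomeryFormFactor α T * cosTransform r α)
    {ε : ℝ} (hε : 0 < ε) :
    ∃ T₀ : ℝ, ∀ T : ℝ, T₀ ≤ T →
      (cosTransform r 0 + 2 * (∫ a in (0 : ℝ)..1, a * cosTransform r a)
          + 2 * (∫ a in (1 : ℝ)..Δ, m a) - ε) * (zetaZeroCount T : ℝ) ≤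
        (pairCorrelationCount (-lam) lam T : ℝ) := by
  classical
  -- the test-function data
  set g : ℝ → ℝ := cosTransform r with hgdef
  have hge : ∀ a, g (-a) = g a := cosTransform_neg r
  have hgi : Integrable g := hti
  have hgc : Continuous g := continuous_cosTransform hev hin
  set B : ℝ := ∫ u, |r u| with hBdef
  have hgB : ∀ a, |g a| ≤ B := abs_cosTransform_le hin
  have hgB' : ∀ a, g a ≤ B := fun a ↦ (le_abs_self _).trans (hgB a)
  have hgB'' : ∀ a, -B ≤ g a := fun a ↦ (abs_le.1 (hgB a)).1
  have hB0 : 0 ≤ B := (abs_nonneg _).trans (hgB 0)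
  have hFg : ∀ x, 𝓕 (fun a : ℝ ↦ (g a : ℂ)) x = (r x : ℂ) :=
    fourier_cosTransform_eq_of_integrable hco hin hev hti
  set cW : ℝ := g 0 + 2 * (∫ a in (0 : ℝ)..1, a * g a) + 2 * (∫ a in (1 : ℝ)..Δ, m a) with hcWdef
  -- the tolerance `η`
  set D : ℝ := 3 + |cW| + 7 * B with hDdef
  have hD0 : 0 < D := by positivity
  set η : ℝ := min (ε / D) (1 / 2) with hηdef
  have hη0 : 0 < η := lt_min (div_pos hε hD0) (by norm_num)
  have hη1 : η ≤ 1 / 2 := min_le_right _ _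
  have hηD : η * D ≤ ε := by
    calc η * D ≤ ε / D * D := mul_le_mul_of_nonneg_right (min_le_left _ _) hD0.le
      _ = ε := div_mul_cancel₀ ε hD0.ne'
  -- continuity of `g` at `0`
  obtain ⟨δ₀, hδ₀, hδ⟩ : ∃ δ₀ > 0, ∀ a : ℝ, |a| < δ₀ → |g a - g 0| < η := by
    obtain ⟨δ₀, hδ₀, h⟩ := Metric.continuous_iff.1 hgc 0 η hη0
    refine ⟨δ₀, hδ₀, fun a ha ↦ ?_⟩
    have := h a (by rwa [Real.dist_eq, sub_zero])
    rwa [Real.dist_eq] at this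
  set δ₁ : ℝ := min (δ₀ / 2) 1 with hδ₁def
  have hδ₁0 : 0 < δ₁ := lt_min (half_pos hδ₀) one_pos
  have hδ₁1 : δ₁ ≤ 1 := min_le_right _ _
  have hgδ : ∀ a ∈ Set.Icc (-δ₁) δ₁, g 0 - η ≤ g a := by
    intro a ha
    have h1 : |a| < δ₀ := by
      rw [abs_lt]; constructor <;> linarith [ha.1, ha.2, min_le_left (δ₀ / 2) 1]
    have h2 := hδ a h1
    rw [abs_lt] at h2; linarith [h2.1]
  -- Montgomery's theorem, the kernel masses, the zero count, the window hypothesis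
  obtain ⟨C, hC⟩ := Montgomery.montgomery_pair_correlation_sqrtLog hRH
  have hK : ∀ {c : ℝ}, 0 < c →
      Tendsto (fun T : ℝ ↦ ∫ a in (-c)..c, T ^ (-2 * |a|) * Real.log T) atTop (𝓝 1) := by
    intro c hc
    have h := Montgomery.tendsto_integral_rpow_abs_mul_log_mul hc (h := fun _ ↦ (1 : ℝ))
      intervalIntegrable_const (B := 1) (fun a _ ↦ by simp) (Cg := 0) (δ := 1) one_pos
      (fun a _ ↦ by simp)
    simpa using h
  have hN := RudnickSarnak.tendsto_zetaZeroCount_div_main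
  obtain ⟨Tw, hTw⟩ := hwin
  have hev' : ∀ᶠ T : ℝ in atTop,
      (cW - ε) * (zetaZeroCount T : ℝ) ≤ (pairCorrelationCount (-lam) lam T : ℝ) := by
    filter_upwards [hC, eventually_gt_atTop (1 : ℝ), eventually_ge_atTop (Real.exp ((|C| / η) ^ 2)),
      eventually_ge_atTop Tw,
      (hK hδ₁0).eventually (Ioo_mem_nhds (show (1 : ℝ) - η < 1 by linarith)
        (show (1 : ℝ) < 1 + η by linarith)),
      (hK one_pos).eventually (Ioo_mem_nhds (show (1 : ℝ) - η < 1 by linarith)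
        (show (1 : ℝ) < 1 + η by linarith)),
      hN.eventually (gt_mem_nhds (show (1 : ℝ) < 1 + η by linarith))]
      with T hCT hT1 hTexp hTw1 hK1 hK2 hNT
    have hT0 : 0 < T := by linarith
    set L : ℝ := Real.log T with hLdef
    have hL : 0 < L := Real.log_pos hT1
    set M : ℝ := T / (2 * π) * L with hMdef
    have hM : 0 < M := by positivity
    -- `|C|/√L ≤ η`
    have hCL : |C| / Real.sqrt L ≤ η := by
      have h1 : (|C| / η) ^ 2 ≤ L := by
        have := Real.log_le_log (Real.exp_pos _) hTexp
        rwa [Real.log_exp] at this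
      have h2 : |C| / η ≤ Real.sqrt L := Real.le_sqrt_of_sq_le h1
      have h3 : 0 < Real.sqrt L := Real.sqrt_pos.2 hL
      rw [div_le_iff₀ h3]
      rw [div_le_iff₀ hη0] at h2
      linarith [mul_comm η (Real.sqrt L)]
    -- Step A: the explicit formula, `Σ r(x_p) w_p = M ∫ F g`
    have hA : ∑ p ∈ zeroIndexSet T ×ˢ zeroIndexSet T,
        r (AH.pairSpacing T p) * montgomeryWeight (zetaOrdinate p.1 - zetaOrdinate p.2) =
        M * ∫ a, montgomeryFormFactor a T * g a := by
      have h := AH.sum_fourier_pairSpacing_eq_integral g hgi hT1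
      simp_rw [hFg] at h
      exact_mod_cast h
    -- Step B: `Σ r(x_p) w_p ≤ #pairs`
    have hBnd : ∑ p ∈ zeroIndexSet T ×ˢ zeroIndexSet T,
        r (AH.pairSpacing T p) * montgomeryWeight (zetaOrdinate p.1 - zetaOrdinate p.2) ≤
        (pairCorrelationCount (-lam) lam T : ℝ) := by
      unfold pairCorrelationCount
      rw [Finset.card_filter]
      push_cast
      refine Finset.sum_le_sum fun p _ ↦ ?_
      split_ifs with hP
      · rcases le_or_gt 0 (r (AH.pairSpacing T p)) with h0 | h0
        · exact (mul_le_of_le_one_right h0 (montgomeryWeight_le_one _)).trans (hle _)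
        · exact (mul_nonpos_of_nonpos_of_nonneg h0.le (montgomeryWeight_pos _).le).trans zero_le_one
      · have hx : lam < |AH.pairSpacing T p| := by
          by_contra hcon
          push Not at hcon
          apply hP
          have h1 : |zetaOrdinate p.1 - zetaOrdinate p.2| ≤ 2 * π * lam / L := by
            rw [AH.pairSpacing, abs_div, abs_mul, abs_of_pos hL, abs_of_pos Real.two_pi_pos,
              div_le_iff₀ Real.two_pi_pos] at hcon
            rw [le_div_iff₀ hL]; linarith
          obtain ⟨h2, h3⟩ := abs_le.1 h1
          exact ⟨by rw [show 2 * π * -lam / L = -(2 * π * lam / L) by ring]; exact h2, h3⟩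
        exact (mul_nonpos_of_nonpos_of_nonneg (hno _ hx) (montgomeryWeight_pos _).le).trans
          le_rfl
    -- Step C: the lower bound for `∫ F g`
    have hFc : Continuous fun a : ℝ ↦ montgomeryFormFactor a T := by
      unfold montgomeryFormFactor; fun_prop
    have hF0 : ∀ a, 0 ≤ montgomeryFormFactor a T := fun a ↦
      Montgomery.montgomeryFormFactor_nonneg a hT1
    have hFgc : Continuous fun a ↦ montgomeryFormFactor a T * g a := hFc.mul hgc
    have hFgi : Integrable fun a ↦ montgomeryFormFactor a T * g a :=
      hgi.bdd_mul (c := |2 * π / (T * Real.log T)| * ((zeroIndexSet T ×ˢ zeroIndexSet T).card : ℝ))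
        hFc.aestronglyMeasurable
        (Eventually.of_forall fun a ↦ by rw [Real.norm_eq_abs]; exact abs_montgomeryFormFactor_le a T)
    -- (C1) drop `|α| > Δ`, where `F g ≥ 0`
    have hΔ0 : 0 < Δ := zero_lt_one.trans_le hΔ
    have hC1 : ∫ a in (-Δ)..Δ, montgomeryFormFactor a T * g a ≤
        ∫ a, montgomeryFormFactor a T * g a := by
      rw [intervalIntegral.integral_of_le (by linarith : -Δ ≤ Δ), ← integral_Icc_eq_integral_Ioc,
        ← integral_add_compl (measurableSet_Icc (a := -Δ) (b := Δ)) hFgi]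
      have h0 : 0 ≤ ∫ a in (Set.Icc (-Δ) Δ)ᶜ, montgomeryFormFactor a T * g a := by
        refine setIntegral_nonneg measurableSet_Icc.compl fun a ha ↦ mul_nonneg (hF0 a) (htail a ?_)
        simp only [Set.mem_compl_iff, Set.mem_Icc, not_and_or, not_le] at ha
        rcases ha with h | h
        · rw [abs_of_neg (by linarith)]; linarith
        · rw [abs_of_pos (by linarith)]; linarith
      linarith
    -- (C2) split `[−Δ, Δ] = [−Δ, −1] ∪ [−1, 1] ∪ [1, Δ]`
    have hii : ∀ a b : ℝ, IntervalIntegrable (fun a ↦ montgomeryFormFactor a T * g a) volume a b :=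
      fun a b ↦ hFgc.intervalIntegrable _ _
    have hsplit : ∫ a in (-Δ)..Δ, montgomeryFormFactor a T * g a =
        (∫ a in (-Δ)..(-1), montgomeryFormFactor a T * g a)
          + (∫ a in (-1 : ℝ)..1, montgomeryFormFactor a T * g a)
          + ∫ a in (1 : ℝ)..Δ, montgomeryFormFactor a T * g a := by
      rw [intervalIntegral.integral_add_adjacent_intervals (hii _ _) (hii _ _),
        intervalIntegral.integral_add_adjacent_intervals (hii _ _) (hii _ _)]
    -- (C3) the two window pieces are `≥ ∫₁^Δ m` each
    have hWR : ∫ a in (1 : ℝ)..Δ, m a ≤ ∫ a in (1 : ℝ)..Δ, montgomeryFormFactor a T * g a := by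
      refine intervalIntegral.integral_mono_on_of_le_Ioo hΔ (hmc.intervalIntegrable _ _) (hii _ _)
        fun a ha ↦ ?_
      have ha0 : 0 < a := by linarith [ha.1]
      exact hTw T hTw1 a (by rw [abs_of_pos ha0]; exact ha.1) (by rw [abs_of_pos ha0]; exact ha.2.le)
    have hWL : ∫ a in (1 : ℝ)..Δ, m a ≤ ∫ a in (-Δ)..(-1), montgomeryFormFactor a T * g a := by
      have e : ∫ a in (1 : ℝ)..Δ, m a = ∫ a in (-Δ)..(-1), m a := by
        have h := intervalIntegral.integral_comp_neg (fun a ↦ m a) (a := (1 : ℝ)) (b := Δ)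
        rw [← h]
        exact intervalIntegral.integral_congr fun a _ ↦ (hme a).symm
      rw [e]
      refine intervalIntegral.integral_mono_on_of_le_Ioo (by linarith) (hmc.intervalIntegrable _ _)
        (hii _ _) fun a ha ↦ ?_
      have ha0 : a < 0 := by linarith [ha.2]
      exact hTw T hTw1 a (by rw [abs_of_neg ha0]; linarith [ha.2])
        (by rw [abs_of_neg ha0]; linarith [ha.1])
    -- the kernel `K(α) = T^{-2|α|} log T`
    set K : ℝ → ℝ := fun a ↦ T ^ (-2 * |a|) * L with hKdef
    have hKc : Continuous K := by
      have e : K = fun a ↦ Real.exp (Real.log T * (-2 * |a|)) * L := by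
        funext a; simp only [hKdef]; rw [Real.rpow_def_of_pos hT0]
      rw [e]; fun_prop
    have hK0 : ∀ a, 0 ≤ K a := fun a ↦ mul_nonneg (Real.rpow_nonneg hT0.le _) hL.le
    -- (C4) Montgomery, two-sided, on `[−1, 1]`: `F g ≥ (K + |α|) g − η (K + 1) B`
    have hMont : ∀ a ∈ Set.Icc (-1 : ℝ) 1,
        (K a + |a|) * g a - η * (K a + 1) * B ≤ montgomeryFormFactor a T * g a := by
      intro a ha
      have ha' : |a| ≤ 1 := abs_le.2 ⟨ha.1, ha.2⟩
      have h1 := hCT a ha'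
      have hKa' : T ^ (-2 * |a|) * Real.log T = K a := by simp only [hKdef, hLdef]
      rw [hKa'] at h1
      have hs : 0 < Real.sqrt L := Real.sqrt_pos.2 hL
      have hKa1 : 0 ≤ K a + 1 := by linarith [hK0 a]
      have h2 : C * (K a + 1) / Real.sqrt L ≤ η * (K a + 1) :=
        calc C * (K a + 1) / Real.sqrt L ≤ |C| * (K a + 1) / Real.sqrt L :=
              div_le_div_of_nonneg_right (mul_le_mul_of_nonneg_right (le_abs_self C) hKa1) hs.le
          _ = |C| / Real.sqrt L * (K a + 1) := by rw [mul_div_right_comm]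
          _ ≤ η * (K a + 1) := mul_le_mul_of_nonneg_right hCL hKa1
      have h3 : |montgomeryFormFactor a T - (K a + |a|)| ≤ η * (K a + 1) := h1.trans h2
      have h4 : |(montgomeryFormFactor a T - (K a + |a|)) * g a| ≤ η * (K a + 1) * B := by
        rw [abs_mul]
        exact mul_le_mul h3 (hgB a) (abs_nonneg _) (by positivity)
      have h5 := (abs_le.1 h4).1
      nlinarith [h5]
    -- the pieces `X = ∫ K g`, `Y = ∫ |α| g`, `V = ∫ (K + 1)` over `[−1, 1]`
    have hKgc : Continuous fun a ↦ K a * g a := hKc.mul hgc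
    have hag : Continuous fun a : ℝ ↦ |a| * g a := by fun_prop
    set X : ℝ := ∫ a in (-1 : ℝ)..1, K a * g a with hXdef
    set Y : ℝ := ∫ a in (-1 : ℝ)..1, |a| * g a with hYdef
    set k : ℝ := ∫ a in (-1 : ℝ)..1, K a with hkdef
    set k₁ : ℝ := ∫ a in (-δ₁)..δ₁, K a with hk₁def
    have hk : 1 - η < k ∧ k < 1 + η := hK2
    have hk₁ : 1 - η < k₁ ∧ k₁ < 1 + η := hK1
    have hlow : X + Y - η * (k + 2) * B ≤ ∫ a in (-1 : ℝ)..1, montgomeryFormFactor a T * g a := by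
      have h1 : ∫ a in (-1 : ℝ)..1, ((K a + |a|) * g a - η * (K a + 1) * B) =
          X + Y - η * (k + 2) * B := by
        have e : ∀ a : ℝ, (K a + |a|) * g a - η * (K a + 1) * B =
            K a * g a + |a| * g a - (η * B) * (K a + 1) := fun a ↦ by ring
        simp_rw [e]
        rw [intervalIntegral.integral_sub, intervalIntegral.integral_add,
          intervalIntegral.integral_const_mul, intervalIntegral.integral_add,
          intervalIntegral.integral_const]
        · simp only [smul_eq_mul]; ring
        · exact hKc.intervalIntegrable _ _
        · exact intervalIntegrable_const
        · exact hKgc.intervalIntegrable _ _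
        · exact hag.intervalIntegrable _ _
        · exact (hKgc.intervalIntegrable _ _).add (hag.intervalIntegrable _ _)
        · exact ((hKc.add continuous_const).intervalIntegrable _ _).const_mul _
      rw [← h1]
      refine intervalIntegral.integral_mono_on (by norm_num)
        ((by fun_prop : Continuous fun a : ℝ ↦
          (K a + |a|) * g a - η * (K a + 1) * B).intervalIntegrable _ _)
        (hii _ _) fun a ha ↦ hMont a ha
    -- `X ≥ g 0 − η(2 + 3B)`: split `[−1, 1]` at `±δ₁`
    have hKii : ∀ a b : ℝ, IntervalIntegrable K volume a b := fun a b ↦ hKc.intervalIntegrable _ _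
    have hKgii : ∀ a b : ℝ, IntervalIntegrable (fun a ↦ K a * g a) volume a b :=
      fun a b ↦ hKgc.intervalIntegrable _ _
    have hXsplit : X = (∫ a in (-1 : ℝ)..(-δ₁), K a * g a) + (∫ a in (-δ₁)..δ₁, K a * g a)
        + ∫ a in δ₁..(1 : ℝ), K a * g a := by
      rw [intervalIntegral.integral_add_adjacent_intervals (hKgii _ _) (hKgii _ _),
        intervalIntegral.integral_add_adjacent_intervals (hKgii _ _) (hKgii _ _)]
    have hksplit : k = (∫ a in (-1 : ℝ)..(-δ₁), K a) + k₁ + ∫ a in δ₁..(1 : ℝ), K a := by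
      rw [intervalIntegral.integral_add_adjacent_intervals (hKii _ _) (hKii _ _),
        intervalIntegral.integral_add_adjacent_intervals (hKii _ _) (hKii _ _)]
    have hXmid : (g 0 - η) * k₁ ≤ ∫ a in (-δ₁)..δ₁, K a * g a := by
      rw [← intervalIntegral.integral_const_mul]
      refine intervalIntegral.integral_mono_on (by linarith) ((hKii _ _).const_mul _)
        (hKgii _ _) fun a ha ↦ ?_
      rw [mul_comm]
      exact mul_le_mul_of_nonneg_left (hgδ a ha) (hK0 a)
    have hXleft : -B * ∫ a in (-1 : ℝ)..(-δ₁), K a ≤ ∫ a in (-1 : ℝ)..(-δ₁), K a * g a := by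
      rw [← intervalIntegral.integral_const_mul]
      refine intervalIntegral.integral_mono_on (by linarith) ((hKii _ _).const_mul _)
        (hKgii _ _) fun a _ ↦ ?_
      rw [show -B * K a = K a * (-B) by ring]
      exact mul_le_mul_of_nonneg_left (hgB'' a) (hK0 a)
    have hXright : -B * ∫ a in δ₁..(1 : ℝ), K a ≤ ∫ a in δ₁..(1 : ℝ), K a * g a := by
      rw [← intervalIntegral.integral_const_mul]
      refine intervalIntegral.integral_mono_on hδ₁1 ((hKii _ _).const_mul _)
        (hKgii _ _) fun a _ ↦ ?_
      rw [show -B * K a = K a * (-B) by ring]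
      exact mul_le_mul_of_nonneg_left (hgB'' a) (hK0 a)
    have hX : g 0 - η * (2 + 3 * B) ≤ X := by
      -- `(g 0 − η) k₁ ≥ g 0 − η − (B + 1) η` and the outer parts `≥ −B (k − k₁) ≥ −2ηB`
      have hg0B : |g 0| ≤ B := hgB 0
      have e1 : (g 0 - η) * k₁ = (g 0 - η) + (g 0 - η) * (k₁ - 1) := by ring
      have e2 : |(g 0 - η) * (k₁ - 1)| ≤ (B + 1) * η := by
        rw [abs_mul]
        refine mul_le_mul ?_ ?_ (abs_nonneg _) (by positivity)
        · calc |g 0 - η| ≤ |g 0| + |η| := abs_sub _ _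
            _ ≤ B + 1 := by rw [abs_of_pos hη0]; linarith
        · rw [abs_le]; constructor <;> linarith [hk₁.1, hk₁.2]
      have e3 := (abs_le.1 e2).1
      have e4 : (∫ a in (-1 : ℝ)..(-δ₁), K a) + ∫ a in δ₁..(1 : ℝ), K a = k - k₁ := by
        linarith [hksplit]
      have e5 : -B * (k - k₁) ≤ (∫ a in (-1 : ℝ)..(-δ₁), K a * g a) + ∫ a in δ₁..(1 : ℝ), K a * g a := by
        rw [← e4, mul_add]; exact add_le_add hXleft hXright
      have e6 : B * (k - k₁) ≤ B * (2 * η) :=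
        mul_le_mul_of_nonneg_left (by linarith [hk.2, hk₁.1]) hB0
      rw [hXsplit]
      linarith [e1, e3, e5, e6, hXmid]
    -- `Y = 2 ∫₀¹ α g`
    have hY : Y = 2 * ∫ a in (0 : ℝ)..1, a * g a := by
      rw [hYdef, integral_abs_mul_of_even hge hgc]
    -- assemble: `∫ F g ≥ cW − η (3 + 7B)` (using `k < 1 + η ≤ 3/2`)
    have hInt : cW - η * (2 + 7 * B) ≤ ∫ a, montgomeryFormFactor a T * g a := by
      have e1 : η * (k + 2) * B ≤ η * 4 * B := by
        have : η * (k + 2) ≤ η * 4 := mul_le_mul_of_nonneg_left (by linarith [hk.2]) hη0.le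
        exact mul_le_mul_of_nonneg_right this hB0
      have e2 : cW = g 0 + Y + 2 * ∫ a in (1 : ℝ)..Δ, m a := by rw [hcWdef, hY]
      have t1 : 2 * (∫ a in (1 : ℝ)..Δ, m a) + (X + Y - η * (k + 2) * B) ≤
          ∫ a in (-Δ)..Δ, montgomeryFormFactor a T * g a := by
        rw [hsplit]; linarith [hlow, hWR, hWL]
      have t2 : cW - η * (2 + 7 * B) ≤ 2 * (∫ a in (1 : ℝ)..Δ, m a) + (X + Y - η * (k + 2) * B) := by
        rw [e2]; linarith [hX, e1]
      exact t2.trans (t1.trans hC1)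
    -- `#pairs ≥ M (cW − η(2 + 7B))` and `N(T) ≤ (1 + η) M`
    have hP2 : M * (cW - η * (2 + 7 * B)) ≤ (pairCorrelationCount (-lam) lam T : ℝ) := by
      calc M * (cW - η * (2 + 7 * B)) ≤ M * ∫ a, montgomeryFormFactor a T * g a :=
            mul_le_mul_of_nonneg_left hInt hM.le
        _ = _ := hA.symm
        _ ≤ _ := hBnd
    have hNle : (zetaZeroCount T : ℝ) ≤ (1 + η) * M := by
      have h1 : (zetaZeroCount T : ℝ) / (T / (2 * π) * Real.log T) < 1 + η := hNT
      rw [div_lt_iff₀ hM] at h1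
      exact h1.le
    -- conclusion
    rcases le_or_gt (cW - ε) 0 with hneg | hpos
    · exact (mul_nonpos_of_nonpos_of_nonneg hneg (Nat.cast_nonneg _)).trans (Nat.cast_nonneg _)
    · have h1 : (cW - ε) * (zetaZeroCount T : ℝ) ≤ (cW - ε) * ((1 + η) * M) :=
        mul_le_mul_of_nonneg_left hNle hpos.le
      have h2 : (cW - ε) * (1 + η) ≤ cW - η * (2 + 7 * B) := by
        have h3 : cW ≤ |cW| := le_abs_self _
        have h4 : η * (cW - ε) + η * (2 + 7 * B) ≤ η * D := by
          rw [← mul_add]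
          exact mul_le_mul_of_nonneg_left (by rw [hDdef]; linarith) hη0.le
        have e5 : (cW - ε) * (1 + η) = (cW - ε) + η * (cW - ε) := by ring
        linarith [h4, hηD, e5]
      calc (cW - ε) * (zetaZeroCount T : ℝ) ≤ (cW - ε) * ((1 + η) * M) := h1
        _ = M * ((cW - ε) * (1 + η)) := by ring
        _ ≤ M * (cW - η * (2 + 7 * B)) := mul_le_mul_of_nonneg_left h2 hM.le
        _ ≤ _ := hP2
  obtain ⟨T₀, hT₀⟩ := eventually_atTop.1 hev'
  exact ⟨T₀, hT₀⟩

end Summit.RiemannHypothesis.RiemannHypothesis.Theorems.GapsEvoDoorsWindow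

end
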